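import Literature.Analysis.FluidPDE.TorusVorticityTensorTransport
import Literature.Analysis.FluidPDE.PassiveScalarForcedClassicalEntropy
import Literature.Analysis.FluidPDE.PassiveScalarMaximumPrinciple
import Literature.Analysis.FluidPDE.PassiveScalarVelocityStability
import Literature.Analysis.FunctionSpaces.TorusDiffMonomialBounds
import Literature.Analysis.FluidPDE.TorusStrainVorticityIsometry
import Literature.Analysis.FunctionSpaces.TorusConvectionLaplacianNormSq
import HarnessLib

/-!
# The vorticity of the linearised Navier–Stokes flow along a smooth field on `T^d`, and its
# planar form `∂ₜω + u·∇ω = νΔω − w·∇Ω̄ + curl g` with the maximum principle and the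
# enstrophy balance of the linearised response

Topic `Literature/Analysis/FluidPDE` (theorems only; no definitions, no named facts). The LINEAR
twin of `TorusVorticityTensorTransport` / `TorusVorticityComponentCoSignedFlux`. Along a jointly
smooth background `u` on `[a, b] × T^d`, a classical solution `(w, q)` of the (forced) linearised
Navier–Stokes equation of the tree (`TorusLinearisedNSEnergy`, `TorusLinearisedNSForcedEnergy`;
Constantin–Foias 1988, Ch. 14 (14.3)–(14.4); Temam 1997, Ch. VI (3.7)–(3.10))

`∂ₜw + (u·∇)w + (w·∇)u = νΔw − ∇q + g`,

has vorticity tensor `Wᵂᵢⱼ = (∂ᵢw)ⱼ − (∂ⱼw)ᵢ` (`torusVorticityTensor (w t) i j`) obeying, pointwise,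

`∂ₜWᵂᵢⱼ + ∑ₖ uₖ∂ₖWᵂᵢⱼ + ∑ₖ wₖ∂ₖWᵁᵢⱼ = νΔWᵂᵢⱼ + (∂ᵢgⱼ − ∂ⱼgᵢ) − Bᵢⱼ(∇u, ∇w)`,
`Bᵢⱼ = ∑ₖ ((∂ᵢu)ₖ(∂ₖw)ⱼ + (∂ᵢw)ₖ(∂ₖu)ⱼ) − ∑ₖ ((∂ⱼu)ₖ(∂ₖw)ᵢ + (∂ⱼw)ₖ(∂ₖu)ᵢ)`

(`Wᵁ` the vorticity tensor of the background) — the antisymmetric part of the gradient of the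
equation, the pressure Hessian being symmetric: the polarisation of Majda–Bertozzi 2002, §1.4
(1.31) `DΩ/Dt + Ω𝒟 + 𝒟Ω = νΔΩ`. In the PLANE (`d = Fin 2`) the stretching–tilting bracket is
`B₀₁ = (div u) Wᵂ₀₁ + (div w) Wᵁ₀₁`, so for divergence-free `u`, `w` the scalar vorticity
`ω = Wᵂ₀₁ = ∂₀w₁ − ∂₁w₀` is a classical FORCED PASSIVE SCALAR of the background,

`∂ₜω + ⟪u, ∇ω⟫ = νΔω + s`,  `s = (∂₀g₁ − ∂₁g₀) − ⟪w, ∇Ω̄⟫`,  `Ω̄ = Wᵁ₀₁ = ∂₀u₁ − ∂₁u₀`,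

which is the vorticity form of the linearised Euler/Navier–Stokes operator of Shvydkoy–Latushkin,
JMFM 7 (2005), §2: `curl(−⟨u,∇⟩v − ⟨v,∇⟩u − ∇P) = −⟨u,∇⟩curl v − ⟨v,∇⟩curl u` "since both `u`
and `v` are divergence free, by standard vector identities" (`Lw = −⟨u,∇⟩w − ⟨curl⁻¹w,∇⟩curl u`).
Consequences recorded here, all from the tree's passive-scalar files applied to `ω`:

* `Torus.linearisedNSForced_timeDerivWithin_torusVorticityTensor` (any `d`) — the transport
  identity above; `Torus.linearisedNSForced_isClassicalScalarTransportForcedOn_torusVorticityTensor`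
  — for divergence-free `u`, each `Wᵂᵢⱼ` is a `Torus.IsClassicalScalarTransportForcedOn` with
  drift `u` and source `(∂ᵢgⱼ − ∂ⱼgᵢ) − Bᵢⱼ − ∑ₖ wₖ∂ₖWᵁᵢⱼ`;
* `Torus.stretchTilt_fin_two` — the planar polynomial identity `B₀₁ = (div u)Wᵂ₀₁ + (div w)Wᵁ₀₁`;
  `Torus.linearisedNSForced_isClassicalScalarTransportForcedOn_vorticity_fin_two` — on `T²`, with
  `div u = div w = 0`, `ω` is a classical forced passive scalar with source
  `(∂₀g₁ − ∂₁g₀) − ⟪w, ∇Ω̄⟫`; unforced form `Torus.linearisedNS_isClassicalScalarTransportForcedOn_vorticity_fin_two`;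
* MAXIMUM PRINCIPLE (`PassiveScalarMaximumPrinciple`, Evans 2010 §7.1.4 with source):
  `Torus.linearisedNSForced_abs_vorticity_le_fin_two` — `|ω(t,x)| ≤ sup|ω(a,·)| + ∫ₐᵗ F` whenever
  `|s(τ,·)| ≤ F(τ)`, `F` continuous; `Torus.linearisedNS_abs_vorticity_le_of_norm_le_fin_two` — the
  unforced form with `F = M_w · G` from `‖w(τ,·)‖ ≤ M_w(τ)`, `‖∇Ω̄(τ,·)‖ ≤ G(τ)`: **the vorticity of
  the linearised response grows at most additively, at rate `sup|w| · sup|∇Ω̄|`, uniformly in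
  `ν ≥ 0`** (transport and diffusion never raise `sup|ω|`);
* ENSTROPHY (`PassiveScalarForcedClassicalEntropy`, `β(r) = r²`):
  `Torus.linearisedNSForced_hasDerivWithinAt_integral_vorticity_sq_fin_two` —
  `d/dt ∫ω² = −2ν∫‖∇ω‖² + 2∫ω s`; `Torus.linearisedNSForced_sqrt_integral_vorticity_sq_le_fin_two` —
  **`‖ω(t)‖₂ ≤ ‖ω(a)‖₂ + ∫ₐᵗ G` whenever `‖s(τ)‖₂ ≤ G(τ)`** (uniformly in `ν ≥ 0`); `L¹`:
  `Torus.linearisedNSForced_integral_abs_vorticity_sub_le_fin_two` — `∫|ω(t)| − ∫|ω(a)| ≤ ∫ₐᵗ∫|s|`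
  (and the any-`d` tensor form `Torus.linearisedNSForced_integral_abs_torusVorticityTensor_sub_le`);
* KINEMATICS on `T²`: `Torus.torusVorticitySqAt_fin_two` (`|ω|² = W₀₁²`),
  `Torus.integral_vorticity_sq_eq_gradNormSq_fin_two` — `∫ ω² = ‖∇w‖₂²` for divergence-free `w`
  (tree `integral_torusVorticitySqAt_eq_two_mul_torusEnstrophy`).

Reading (cell `ad-ideate`, route SawtoothPulseCascade, items K2″/K2Lip/ApproxSol58): for the
linearised response `L` about the pulsed shear `ū = r(t)U(xᵢ)eⱼ` one has `∇Ω̄ = ±r U″(xᵢ)eᵢ`, so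
`sup|ω_L|` is fed only by the CROSS-STREAM component of `L` on the corner collars of `U` — the
entry point of a vorticity-topology (Lipschitz) analysis of the response; nothing here bounds
`‖∇L‖_∞` by `sup|ω_L|` (that is the Biot–Savart / BKM step, `TorusBKMGradientLogBound` on `T³`).

## Mathlib / tree search

Reused: `torusVorticityTensor`, `torusVorticitySqAt`, `integral_torusVorticitySqAt_eq_two_mul_torusEnstrophy`
(`TorusStrainVorticityIsometry`), `Torus.timeDerivWithin_partialDeriv_comm`,
`Torus.partialDeriv_laplacian_comm`, `Torus.partialDeriv_comm`, `Torus.partialDeriv_apply_coord`,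
`Torus.partialDeriv_convect_eq_add_convect` (`TorusConvectionLaplacianNormSq`),
`Torus.convect_eq_sum_smul_partialDeriv`, `Torus.gradient_apply`, `Torus.inner_gradient_eq_sum_mul_partialDeriv`,
`Torus.IsClassicalScalarTransportForcedOn` + `.hasDerivWithinAt_integral_comp` / `.integral_abs_sub_le` /
`.congr_source` / `.restrict_Icc` (`PassiveScalarForcedClassicalEntropy`), `Torus.abs_le_add_integral_of_source`
(`PassiveScalarMaximumPrinciple`), `Torus.sqrt_le_sqrt_add_integral_of_hasDerivWithinAt`
(`PassiveScalarVelocityStability`), `Torus.integral_mul_le_sqrt_mul_sqrt` (`TorusDiffMonomialBounds`). The pattern is `IsClassicalNSSolutionOn.timeDerivWithin_torusVorticityTensor`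
(nonlinear, one field); searched `linearisedNS.*orticity|orticity.*linearisedNS` in `Literature/`:
nothing — the linearised vorticity equation was not in the tree in any dimension.

## References

* R. Shvydkoy, Y. Latushkin, *Essential spectrum of the linearized 2D Euler equation and
  Lyapunov–Oseledets exponents*, J. Math. Fluid Mech. 7 (2005) 164–178, §2 (the operators
  `L_vel v = −⟨u,∇⟩v − ⟨v,∇⟩u − ∇P` and `Lw = −⟨u,∇⟩w − ⟨curl⁻¹w,∇⟩curl u`, and the identity
  `curl L_vel v = L curl v` before Remark 1; held arXiv:math-ph/0306026). [ShvydkoyLatushkin2005]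
* A. J. Majda, A. L. Bertozzi, *Vorticity and Incompressible Flow*, CUP 2002, §1.4 (1.29)–(1.32),
  §2.1 (2.5)–(2.6) (scalar vorticity equation of planar flows), §3.3 before Cor. 3.3 (maximum
  principle for the planar vorticity). [MajdaBertozziCUP2002]
* P. Constantin, C. Foias, *Navier–Stokes Equations*, Chicago 1988, Ch. 14 (14.3)–(14.4) (the
  linearised equation). [ConstantinFoiasNSE1988]
* L. C. Evans, *Partial Differential Equations*, 2nd ed. 2010, §7.1.4 Thms. 8–9 (weak maximum
  principle with source), App. C.2. [Evans2010]
-/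

noncomputable section

open Set MeasureTheory Finset
open scoped ContDiff InnerProductSpace RealInnerProductSpace

namespace Literature.Analysis.FluidPDE

namespace Torus

open Literature.Analysis.FunctionSpaces
open Literature.Analysis.FunctionSpaces.Torus

variable {d : Type*} [Fintype d] [DecidableEq d]

/-! ### Calculus complements (file-private copies of the helpers of `TorusVorticityTensorTransport`) -/

namespace LinearisedVorticity

omit [DecidableEq d] in
/-- Coordinates of the vector Laplacian: `(Δv)ⱼ = Δ(vⱼ)` for smooth `v`. [folklore] -/
private theorem laplacian_apply_coord {v : UnitAddTorus d → EuclideanSpace ℝ d}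
    (hv : Torus.IsSmooth v) (x : UnitAddTorus d) (j : d) :
    Torus.laplacian v x j = Torus.laplacian (fun y => v y j) x := by
  have h2 : ContDiffAt ℝ 2 (Torus.liftAt v x) 0 :=
    ((hv.liftAt x).of_le (WithTop.coe_le_coe.mpr le_top)).contDiffAt
  have key := h2.laplacian_CLM_comp_left
    (l := (EuclideanSpace.proj j : EuclideanSpace ℝ d →L[ℝ] ℝ))
  have hl : Torus.liftAt (fun y => v y j) x =
      (EuclideanSpace.proj j : EuclideanSpace ℝ d →L[ℝ] ℝ) ∘ Torus.liftAt v x := rfl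
  simp only [Torus.laplacian, hl, key, Function.comp_apply]
  rfl

omit [DecidableEq d] in
/-- Coordinates of one-sided time derivatives: `(∂ₜφ)ⱼ = ∂ₜ(φⱼ)` for jointly smooth `φ`. [folklore] -/
private theorem timeDerivWithin_apply_coord {S : Set ℝ} {φ : ℝ → UnitAddTorus d → EuclideanSpace ℝ d}
    (hφ : Torus.IsSmoothSpaceTimeOn S φ) (hS : UniqueDiffOn ℝ S) {t : ℝ} (ht : t ∈ S)
    (x : UnitAddTorus d) (j : d) :
    Torus.timeDerivWithin S (fun s y => φ s y j) t x = Torus.timeDerivWithin S φ t x j := by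
  have h := hφ.hasDerivWithinAt_slice ht x
  have h2 : HasDerivWithinAt (fun τ => φ τ x j) (Torus.timeDerivWithin S φ t x j) S t :=
    (EuclideanSpace.proj j : EuclideanSpace ℝ d →L[ℝ] ℝ).hasFDerivAt.comp_hasDerivWithinAt t h
  exact h2.derivWithin (hS t ht)

/-- `∂ₖWᵢⱼ = (∂ₖ∂ᵢv)ⱼ − (∂ₖ∂ⱼv)ᵢ` for smooth `v`. [folklore] -/
private theorem partialDeriv_torusVorticityTensor {v : UnitAddTorus d → EuclideanSpace ℝ d}
    (hv : Torus.IsSmooth v) (i j k : d) (x : UnitAddTorus d) :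
    Torus.partialDeriv k (torusVorticityTensor v i j) x =
      Torus.partialDeriv k (Torus.partialDeriv i v) x j -
        Torus.partialDeriv k (Torus.partialDeriv j v) x i := by
  have hi : Torus.IsContDiff 1 (fun y => Torus.partialDeriv i v y j) :=
    ((hv.partialDeriv i).apply j).isContDiff (by simp)
  have hj : Torus.IsContDiff 1 (fun y => -Torus.partialDeriv j v y i) :=
    ((hv.partialDeriv j).apply i).neg.isContDiff (by simp)
  have hfun : torusVorticityTensor v i j =
      (fun y => Torus.partialDeriv i v y j) + fun y => -Torus.partialDeriv j v y i := by
    funext y; simp [torusVorticityTensor, sub_eq_add_neg]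
  rw [hfun, Torus.partialDeriv_add hi hj k, Pi.add_apply, Torus.partialDeriv_neg,
    Torus.partialDeriv_apply_coord ((hv.partialDeriv i).isContDiff (by simp)),
    Torus.partialDeriv_apply_coord ((hv.partialDeriv j).isContDiff (by simp))]
  ring

/-- `Wᵢⱼ` of a smooth field is smooth. [folklore] -/
private theorem isSmooth_torusVorticityTensor {v : UnitAddTorus d → EuclideanSpace ℝ d}
    (hv : Torus.IsSmooth v) (i j : d) : Torus.IsSmooth (torusVorticityTensor v i j) :=
  ((hv.partialDeriv i).apply j).sub ((hv.partialDeriv j).apply i)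

/-- `ΔWᵢⱼ = (∂ᵢΔv)ⱼ − (∂ⱼΔv)ᵢ` for smooth `v`. [folklore] -/
private theorem laplacian_torusVorticityTensor {v : UnitAddTorus d → EuclideanSpace ℝ d}
    (hv : Torus.IsSmooth v) (i j : d) (x : UnitAddTorus d) :
    Torus.laplacian (torusVorticityTensor v i j) x =
      Torus.partialDeriv i (Torus.laplacian v) x j - Torus.partialDeriv j (Torus.laplacian v) x i := by
  have hi : Torus.IsSmooth (fun y => Torus.partialDeriv i v y j) := (hv.partialDeriv i).apply j
  have hj : Torus.IsSmooth (fun y => Torus.partialDeriv j v y i) := (hv.partialDeriv j).apply i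
  have hfun : torusVorticityTensor v i j =
      (fun y => Torus.partialDeriv i v y j) + (-1 : ℝ) • fun y => Torus.partialDeriv j v y i := by
    funext y; simp [torusVorticityTensor, sub_eq_add_neg]
  rw [hfun, Torus.laplacian_add_apply hi (hj.smul (-1)), Torus.laplacian_const_smul_apply hj,
    Torus.partialDeriv_laplacian_comm hv i, Torus.partialDeriv_laplacian_comm hv j,
    laplacian_apply_coord (hv.partialDeriv i), laplacian_apply_coord (hv.partialDeriv j), smul_eq_mul]
  ring

/-- Coordinates of the gradient of a convective derivative of one smooth field along another:
`(∂ₘ((v·∇)z))ₙ = ∑ₖ vₖ (∂ₖ∂ₘz)ₙ + ∑ₖ (∂ₘv)ₖ (∂ₖz)ₙ` (`Torus.partialDeriv_convect_eq_add_convect`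
read in coordinates). [folklore] -/
private theorem partialDeriv_convect_apply {v z : UnitAddTorus d → EuclideanSpace ℝ d}
    (hv : Torus.IsSmooth v) (hz : Torus.IsSmooth z) (m n : d) (x : UnitAddTorus d) :
    Torus.partialDeriv m (Torus.convect v z) x n =
      (∑ k, v x k * Torus.partialDeriv k (Torus.partialDeriv m z) x n) +
        ∑ k, Torus.partialDeriv m v x k * Torus.partialDeriv k z x n := by
  rw [Torus.partialDeriv_convect_eq_add_convect hv hz m x,
    Torus.convect_eq_sum_smul_partialDeriv ((hz.partialDeriv m).isContDiff (by simp)) x,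
    Torus.convect_eq_sum_smul_partialDeriv (hz.isContDiff (by simp)) x]
  simp only [WithLp.ofLp_sum, WithLp.ofLp_add, WithLp.ofLp_smul, Finset.sum_apply, Pi.add_apply,
    Pi.smul_apply, smul_eq_mul]

end LinearisedVorticity

open LinearisedVorticity

/-! ### Part 1. The vorticity-tensor transport identity of the linearised equation (any `d`) -/

section AnyDimension

variable {a b ν : ℝ} {u w g : ℝ → UnitAddTorus d → EuclideanSpace ℝ d} {q : ℝ → UnitAddTorus d → ℝ}

/-- The force of a classical solution of the linearised equation
`∂ₜw + (u·∇)w + (w·∇)u = νΔw − ∇q + g` (Constantin–Foias 1988, Ch. 14, (14.3)–(14.4), with a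
right-hand side) is jointly smooth on `[a, b]`, `a < b`: `g = ∂ₜw + (u·∇)w + (w·∇)u − νΔw + ∇q`,
each term jointly smooth for jointly smooth `u, w, q`. [cite: ConstantinFoiasNSE1988, Ch. 14 (14.3)–(14.4)] -/
theorem linearisedNSForced_isSmoothSpaceTimeOn_force
    (hu : Torus.IsSmoothSpaceTimeOn (Icc a b) u) (hw : Torus.IsSmoothSpaceTimeOn (Icc a b) w)
    (hq : Torus.IsSmoothSpaceTimeOn (Icc a b) q)
    (hlin : ∀ t ∈ Icc a b, ∀ x, Torus.timeDerivWithin (Icc a b) w t x + Torus.convect (u t) (w t) x +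
      Torus.convect (w t) (u t) x = ν • Torus.laplacian (w t) x - Torus.gradient (q t) x + g t x)
    (hab : a < b) : Torus.IsSmoothSpaceTimeOn (Icc a b) g := by
  have hU : UniqueDiffOn ℝ (Icc a b) := uniqueDiffOn_Icc hab
  have hG : Torus.IsSmoothSpaceTimeOn (Icc a b) (fun t x => Torus.timeDerivWithin (Icc a b) w t x +
      Torus.convect (u t) (w t) x + Torus.convect (w t) (u t) x - ν • Torus.laplacian (w t) x +
      Torus.gradient (q t) x) :=
    ((((hw.timeDerivWithin hU).add (hu.convect hw hU)).add (hw.convect hu hU)).sub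
      ((hw.laplacian hU).const_smul ν)).add (hq.gradient hU)
  refine ContDiffOn.congr hG fun z hz => ?_
  obtain ⟨t, y⟩ := z
  have ht : t ∈ Icc a b := (mem_prod.1 hz).1
  simp only [Torus.stLift_apply]
  rw [hlin t ht (Torus.proj y)]
  abel

/-- **The vorticity-tensor transport identity of the linearised Navier–Stokes equation** (any
dimension). Along a jointly smooth background `u` on `[a, b] × T^d` (`a < b`), for a classical
solution of `∂ₜw + (u·∇)w + (w·∇)u = νΔw − ∇q + g` (jointly smooth `w`, `q`), every `t ∈ [a, b]`,
point `x` and indices `i, j`, with `Wᵛᵢⱼ = (∂ᵢv)ⱼ − (∂ⱼv)ᵢ` (`torusVorticityTensor`):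
`∂ₜWᵂᵢⱼ = νΔWᵂᵢⱼ + (∂ᵢgⱼ − ∂ⱼgᵢ) − [∑ₖ((∂ᵢu)ₖ(∂ₖw)ⱼ + (∂ᵢw)ₖ(∂ₖu)ⱼ) − ∑ₖ((∂ⱼu)ₖ(∂ₖw)ᵢ + (∂ⱼw)ₖ(∂ₖu)ᵢ)]
 − ∑ₖ uₖ∂ₖWᵂᵢⱼ − ∑ₖ wₖ∂ₖWᵁᵢⱼ` — the antisymmetric part of `∂ᵢ` of the equation (the pressure
Hessian is symmetric and drops out); the polarisation in `(u, w)` of Majda–Bertozzi 2002, §1.4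
(1.31) `DΩ/Dt + Ω𝒟 + 𝒟Ω = νΔΩ` (tree `IsClassicalNSSolutionOn.timeDerivWithin_torusVorticityTensor`),
i.e. the curl of the linearised operator `−⟨u,∇⟩v − ⟨v,∇⟩u − ∇P` of Shvydkoy–Latushkin 2005, §2.
No incompressibility is used. [cite: MajdaBertozziCUP2002, §1.4 eq. (1.31)] -/
theorem linearisedNSForced_timeDerivWithin_torusVorticityTensor
    (hu : Torus.IsSmoothSpaceTimeOn (Icc a b) u) (hw : Torus.IsSmoothSpaceTimeOn (Icc a b) w)
    (hq : Torus.IsSmoothSpaceTimeOn (Icc a b) q)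
    (hlin : ∀ t ∈ Icc a b, ∀ x, Torus.timeDerivWithin (Icc a b) w t x + Torus.convect (u t) (w t) x +
      Torus.convect (w t) (u t) x = ν • Torus.laplacian (w t) x - Torus.gradient (q t) x + g t x)
    (hab : a < b) {t : ℝ} (ht : t ∈ Icc a b) (i j : d) (x : UnitAddTorus d) :
    Torus.timeDerivWithin (Icc a b) (fun s y => torusVorticityTensor (w s) i j y) t x =
      ν * Torus.laplacian (torusVorticityTensor (w t) i j) x +
        (Torus.partialDeriv i (g t) x j - Torus.partialDeriv j (g t) x i) -
        ((∑ k, (Torus.partialDeriv i (u t) x k * Torus.partialDeriv k (w t) x j +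
            Torus.partialDeriv i (w t) x k * Torus.partialDeriv k (u t) x j)) -
          ∑ k, (Torus.partialDeriv j (u t) x k * Torus.partialDeriv k (w t) x i +
            Torus.partialDeriv j (w t) x k * Torus.partialDeriv k (u t) x i)) -
        ∑ k, u t x k * Torus.partialDeriv k (torusVorticityTensor (w t) i j) x -
        ∑ k, w t x k * Torus.partialDeriv k (torusVorticityTensor (u t) i j) x := by
  set S : Set ℝ := Icc a b with hSdef
  have hU : UniqueDiffOn ℝ S := uniqueDiffOn_Icc hab
  have hut : Torus.IsSmooth (u t) := hu.isSmooth_slice ht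
  have hwt : Torus.IsSmooth (w t) := hw.isSmooth_slice ht
  have hqt : Torus.IsSmooth (q t) := hq.isSmooth_slice ht
  set A : UnitAddTorus d → EuclideanSpace ℝ d := Torus.timeDerivWithin S w t with hAdef
  have hA : Torus.IsSmooth A := hw.isSmooth_timeDerivWithin hU ht
  have hΔ : Torus.IsSmooth (Torus.laplacian (w t)) := hwt.laplacian
  have hC1 : Torus.IsSmooth (Torus.convect (u t) (w t)) := hut.convect hwt
  have hC2 : Torus.IsSmooth (Torus.convect (w t) (u t)) := hwt.convect hut
  have hG : Torus.IsSmooth (Torus.gradient (q t)) := hqt.gradient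
  have hDi : ∀ m, Torus.IsSmoothSpaceTimeOn S (fun s => Torus.partialDeriv m (w s)) :=
    fun m => hw.partialDeriv hU m
  -- the forcing slice is smooth (the equation)
  have hg : Torus.IsSmooth (g t) :=
    (linearisedNSForced_isSmoothSpaceTimeOn_force hu hw hq hlin hab).isSmooth_slice ht
  -- Step 1: `∂ₜWᵂᵢⱼ = (∂ᵢ∂ₜw)ⱼ − (∂ⱼ∂ₜw)ᵢ`
  have hslice : ∀ m n, HasDerivWithinAt (fun s => Torus.partialDeriv m (w s) x n)
      (Torus.partialDeriv m A x n) S t := by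
    intro m n
    have h1 := ((hDi m).apply n).hasDerivWithinAt_slice ht x
    rw [timeDerivWithin_apply_coord (hDi m) hU ht x n,
      Torus.timeDerivWithin_partialDeriv_comm hab hw ht m x] at h1
    exact h1
  have hW : HasDerivWithinAt (fun s => torusVorticityTensor (w s) i j x)
      (Torus.partialDeriv i A x j - Torus.partialDeriv j A x i) S t :=
    (hslice i j).sub (hslice j i)
  rw [Torus.timeDerivWithin, hW.derivWithin (hU t ht)]
  -- Step 2: `∂ₘ A` from the equation
  have hAfun : A = ν • Torus.laplacian (w t) + ((fun y => -Torus.gradient (q t) y) +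
      (g t + ((fun y => -Torus.convect (u t) (w t) y) + fun y => -Torus.convect (w t) (u t) y))) := by
    funext y
    have := hlin t ht y
    simp only [Pi.add_apply, Pi.smul_apply]
    rw [hAdef, eq_sub_of_add_eq (eq_sub_of_add_eq this)]
    abel
  have c1 : Torus.IsContDiff 1 (ν • Torus.laplacian (w t)) := (hΔ.smul ν).isContDiff (by simp)
  have c2 : Torus.IsContDiff 1 (fun y => -Torus.gradient (q t) y) := hG.neg.isContDiff (by simp)
  have c3 : Torus.IsContDiff 1 (g t) := hg.isContDiff (by simp)
  have c4 : Torus.IsContDiff 1 (fun y => -Torus.convect (u t) (w t) y) := hC1.neg.isContDiff (by simp)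
  have c5 : Torus.IsContDiff 1 (fun y => -Torus.convect (w t) (u t) y) := hC2.neg.isContDiff (by simp)
  have hDA : ∀ m, Torus.partialDeriv m A x = ν • Torus.partialDeriv m (Torus.laplacian (w t)) x -
      Torus.partialDeriv m (Torus.gradient (q t)) x + Torus.partialDeriv m (g t) x -
      Torus.partialDeriv m (Torus.convect (u t) (w t)) x -
      Torus.partialDeriv m (Torus.convect (w t) (u t)) x := by
    intro m
    rw [hAfun, Torus.partialDeriv_add c1 (c2.add (c3.add (c4.add c5))) m,
      Torus.partialDeriv_add c2 (c3.add (c4.add c5)) m, Torus.partialDeriv_add c3 (c4.add c5) m,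
      Torus.partialDeriv_add c4 c5 m]
    simp only [Pi.add_apply]
    rw [Torus.partialDeriv_const_smul (hΔ.isContDiff (by simp)) ν m, Pi.smul_apply,
      Torus.partialDeriv_neg, Torus.partialDeriv_neg, Torus.partialDeriv_neg]
    abel
  -- coordinates of the pieces
  have hgrad : ∀ m n, Torus.partialDeriv m (Torus.gradient (q t)) x n =
      Torus.partialDeriv m (Torus.partialDeriv n (q t)) x := by
    intro m n
    rw [← Torus.partialDeriv_apply_coord (hG.isContDiff (by simp)) m x n]
    congr 1
    funext y
    exact Torus.gradient_apply (hqt.isContDiff (by simp)) y n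
  have hpress : Torus.partialDeriv i (Torus.gradient (q t)) x j =
      Torus.partialDeriv j (Torus.gradient (q t)) x i := by
    rw [hgrad, hgrad, Torus.partialDeriv_comm hqt]
  have hconv1 : ∀ m n, Torus.partialDeriv m (Torus.convect (u t) (w t)) x n =
      (∑ k, u t x k * Torus.partialDeriv k (Torus.partialDeriv m (w t)) x n) +
        ∑ k, Torus.partialDeriv m (u t) x k * Torus.partialDeriv k (w t) x n :=
    fun m n => partialDeriv_convect_apply hut hwt m n x
  have hconv2 : ∀ m n, Torus.partialDeriv m (Torus.convect (w t) (u t)) x n =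
      (∑ k, w t x k * Torus.partialDeriv k (Torus.partialDeriv m (u t)) x n) +
        ∑ k, Torus.partialDeriv m (w t) x k * Torus.partialDeriv k (u t) x n :=
    fun m n => partialDeriv_convect_apply hwt hut m n x
  have hvisc : ν * Torus.laplacian (torusVorticityTensor (w t) i j) x =
      ν * Torus.partialDeriv i (Torus.laplacian (w t)) x j -
        ν * Torus.partialDeriv j (Torus.laplacian (w t)) x i := by
    rw [laplacian_torusVorticityTensor hwt]; ring
  have htransU : ∑ k, u t x k * Torus.partialDeriv k (torusVorticityTensor (w t) i j) x =
      (∑ k, u t x k * Torus.partialDeriv k (Torus.partialDeriv i (w t)) x j) -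
        ∑ k, u t x k * Torus.partialDeriv k (Torus.partialDeriv j (w t)) x i := by
    rw [← Finset.sum_sub_distrib]
    refine Finset.sum_congr rfl fun k _ => ?_
    rw [partialDeriv_torusVorticityTensor hwt]; ring
  have htransW : ∑ k, w t x k * Torus.partialDeriv k (torusVorticityTensor (u t) i j) x =
      (∑ k, w t x k * Torus.partialDeriv k (Torus.partialDeriv i (u t)) x j) -
        ∑ k, w t x k * Torus.partialDeriv k (Torus.partialDeriv j (u t)) x i := by
    rw [← Finset.sum_sub_distrib]
    refine Finset.sum_congr rfl fun k _ => ?_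
    rw [partialDeriv_torusVorticityTensor hut]; ring
  rw [hvisc, htransU, htransW]
  simp only [hDA, WithLp.ofLp_sub, WithLp.ofLp_add, WithLp.ofLp_smul, Pi.sub_apply, Pi.add_apply,
    Pi.smul_apply, smul_eq_mul, hconv1, hconv2, hpress, Finset.sum_add_distrib]
  ring

omit [DecidableEq d] in
/-- Finite sums of jointly smooth scalar fields are jointly smooth. [folklore] -/
private theorem isSmoothSpaceTimeOn_fsum {S : Set ℝ} {φ : d → ℝ → UnitAddTorus d → ℝ}
    (hφ : ∀ k, Torus.IsSmoothSpaceTimeOn S (φ k)) :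
    Torus.IsSmoothSpaceTimeOn S (fun t x => ∑ k, φ k t x) := by
  have := Torus.IsSmoothSpaceTimeOn.sum (s := Finset.univ) fun k (_ : k ∈ Finset.univ) => hφ k
  refine ContDiffOn.congr this fun z _ => ?_
  obtain ⟨t, y⟩ := z
  simp only [Torus.stLift_apply]

/-- The vorticity tensor `Wᵢⱼ = (∂ᵢu)ⱼ − (∂ⱼu)ᵢ` (Majda–Bertozzi 2002, §1.4 (1.19), `W = −2Ω`)
of a jointly smooth field is jointly smooth on `[a, b] × T^d`, `a < b`. [cite: MajdaBertozziCUP2002, §1.4 eq. (1.19)] -/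
theorem isSmoothSpaceTimeOn_torusVorticityTensor (hu : Torus.IsSmoothSpaceTimeOn (Icc a b) u)
    (hab : a < b) (i j : d) :
    Torus.IsSmoothSpaceTimeOn (Icc a b) (fun t x => torusVorticityTensor (u t) i j x) :=
  ((hu.partialDeriv (uniqueDiffOn_Icc hab) i).apply j).sub ((hu.partialDeriv (uniqueDiffOn_Icc hab) j).apply i)

/-- The source of the vorticity-tensor entry `Wᵂᵢⱼ` of the linearised equation,
`(∂ᵢgⱼ − ∂ⱼgᵢ) − Bᵢⱼ(∇u, ∇w) − ∑ₖ wₖ∂ₖWᵁᵢⱼ`, is jointly smooth on `[a, b]`, `a < b`. [folklore] -/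
private theorem isSmoothSpaceTimeOn_linSource
    (hu : Torus.IsSmoothSpaceTimeOn (Icc a b) u) (hw : Torus.IsSmoothSpaceTimeOn (Icc a b) w)
    (hq : Torus.IsSmoothSpaceTimeOn (Icc a b) q)
    (hlin : ∀ t ∈ Icc a b, ∀ x, Torus.timeDerivWithin (Icc a b) w t x + Torus.convect (u t) (w t) x +
      Torus.convect (w t) (u t) x = ν • Torus.laplacian (w t) x - Torus.gradient (q t) x + g t x)
    (hab : a < b) (i j : d) :
    Torus.IsSmoothSpaceTimeOn (Icc a b) (fun t x =>
      (Torus.partialDeriv i (g t) x j - Torus.partialDeriv j (g t) x i) -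
        ((∑ k, (Torus.partialDeriv i (u t) x k * Torus.partialDeriv k (w t) x j +
            Torus.partialDeriv i (w t) x k * Torus.partialDeriv k (u t) x j)) -
          ∑ k, (Torus.partialDeriv j (u t) x k * Torus.partialDeriv k (w t) x i +
            Torus.partialDeriv j (w t) x k * Torus.partialDeriv k (u t) x i)) -
        ∑ k, w t x k * Torus.partialDeriv k (torusVorticityTensor (u t) i j) x) := by
  have hU : UniqueDiffOn ℝ (Icc a b) := uniqueDiffOn_Icc hab
  have hgst := linearisedNSForced_isSmoothSpaceTimeOn_force hu hw hq hlin hab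
  have hDu : ∀ m n, Torus.IsSmoothSpaceTimeOn (Icc a b) (fun t x => Torus.partialDeriv m (u t) x n) :=
    fun m n => (hu.partialDeriv hU m).apply n
  have hDw : ∀ m n, Torus.IsSmoothSpaceTimeOn (Icc a b) (fun t x => Torus.partialDeriv m (w t) x n) :=
    fun m n => (hw.partialDeriv hU m).apply n
  have hDg : ∀ m n, Torus.IsSmoothSpaceTimeOn (Icc a b) (fun t x => Torus.partialDeriv m (g t) x n) :=
    fun m n => (hgst.partialDeriv hU m).apply n
  have hW : Torus.IsSmoothSpaceTimeOn (Icc a b) (fun t => torusVorticityTensor (u t) i j) :=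
    isSmoothSpaceTimeOn_torusVorticityTensor hu hab i j
  have hDW : ∀ k, Torus.IsSmoothSpaceTimeOn (Icc a b)
      (fun t x => Torus.partialDeriv k (torusVorticityTensor (u t) i j) x) :=
    fun k => hW.partialDeriv hU k
  exact (((hDg i j).sub (hDg j i)).sub
    ((isSmoothSpaceTimeOn_fsum fun k => ((hDu i k).mul (hDw k j)).add ((hDw i k).mul (hDu k j))).sub
      (isSmoothSpaceTimeOn_fsum fun k => ((hDu j k).mul (hDw k i)).add ((hDw j k).mul (hDu k i))))).sub
    (isSmoothSpaceTimeOn_fsum fun k => (hw.apply k).mul (hDW k))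

/-- **Every vorticity-tensor entry of the linearised flow is a forced passive scalar of the
background.** Along a jointly smooth divergence-free background `u` on `[a, b] × T^d` (`a < b`),
for a classical solution `(w, q)` of `∂ₜw + (u·∇)w + (w·∇)u = νΔw − ∇q + g`, each entry
`Wᵂᵢⱼ(t, x) = (∂ᵢw)ⱼ − (∂ⱼw)ᵢ` is a classical solution of the forced passive-scalar equation
`∂ₜWᵂᵢⱼ + ⟪u, ∇Wᵂᵢⱼ⟫ = νΔWᵂᵢⱼ + sᵢⱼ` with the divergence-free drift `u` and the source
`sᵢⱼ = (∂ᵢgⱼ − ∂ⱼgᵢ) − Bᵢⱼ(∇u, ∇w) − ∑ₖ wₖ∂ₖWᵁᵢⱼ` (`Bᵢⱼ` the stretching–tilting bracket of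
`linearisedNSForced_timeDerivWithin_torusVorticityTensor`, `Wᵁ` the background vorticity
tensor): Majda–Bertozzi 2002 (1.31) polarised, read as a scalar equation (the nonlinear twin is
`IsClassicalNSSolutionOn.isClassicalScalarTransportForcedOn_torusVorticityTensor`). No
incompressibility of `w` is needed. [cite: MajdaBertozziCUP2002, §1.4 eq. (1.31)] -/
theorem linearisedNSForced_isClassicalScalarTransportForcedOn_torusVorticityTensor
    (hu : Torus.IsSmoothSpaceTimeOn (Icc a b) u) (hudiv : ∀ t ∈ Icc a b, Torus.IsDivFree (u t))
    (hw : Torus.IsSmoothSpaceTimeOn (Icc a b) w) (hq : Torus.IsSmoothSpaceTimeOn (Icc a b) q)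
    (hlin : ∀ t ∈ Icc a b, ∀ x, Torus.timeDerivWithin (Icc a b) w t x + Torus.convect (u t) (w t) x +
      Torus.convect (w t) (u t) x = ν • Torus.laplacian (w t) x - Torus.gradient (q t) x + g t x)
    (hab : a < b) (i j : d) :
    Torus.IsClassicalScalarTransportForcedOn (Icc a b) ν u
      (fun t x => (Torus.partialDeriv i (g t) x j - Torus.partialDeriv j (g t) x i) -
        ((∑ k, (Torus.partialDeriv i (u t) x k * Torus.partialDeriv k (w t) x j +
            Torus.partialDeriv i (w t) x k * Torus.partialDeriv k (u t) x j)) -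
          ∑ k, (Torus.partialDeriv j (u t) x k * Torus.partialDeriv k (w t) x i +
            Torus.partialDeriv j (w t) x k * Torus.partialDeriv k (u t) x i)) -
        ∑ k, w t x k * Torus.partialDeriv k (torusVorticityTensor (u t) i j) x)
      (fun t x => torusVorticityTensor (w t) i j x) := by
  have hWst := isSmoothSpaceTimeOn_torusVorticityTensor hw hab i j
  refine ⟨hu, isSmoothSpaceTimeOn_linSource hu hw hq hlin hab i j, hWst, fun t ht x => ?_, hudiv⟩
  have key := linearisedNSForced_timeDerivWithin_torusVorticityTensor hu hw hq hlin hab ht i j x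
  have hW : Torus.IsSmooth (fun x => torusVorticityTensor (w t) i j x) := hWst.isSmooth_slice ht
  have hconv := Torus.inner_gradient_eq_sum_mul_partialDeriv (hW.isContDiff (by decide)) (u t x) x
  have eW : (fun x => torusVorticityTensor (w t) i j x) = torusVorticityTensor (w t) i j := rfl
  rw [hconv, eW, key]
  ring

/-- **`L¹` growth of a vorticity-tensor entry of the linearised flow** (any `d`, `ν ≥ 0`):
`∫ |Wᵂᵢⱼ(t)| − ∫ |Wᵂᵢⱼ(a)| ≤ ∫ₐᵗ ∫ |sᵢⱼ|` on `[a, b]`, `sᵢⱼ` the source of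
`linearisedNSForced_isClassicalScalarTransportForcedOn_torusVorticityTensor` — incompressible
transport and diffusion never raise the `L¹` norm of a passive scalar (Gallay–Wayne 2005,
Lemma 3.1; tree `IsClassicalScalarTransportForcedOn.integral_abs_sub_le`). [cite: GallayWayne2005, Lemma 3.1] -/
theorem linearisedNSForced_integral_abs_torusVorticityTensor_sub_le
    (hu : Torus.IsSmoothSpaceTimeOn (Icc a b) u) (hudiv : ∀ t ∈ Icc a b, Torus.IsDivFree (u t))
    (hw : Torus.IsSmoothSpaceTimeOn (Icc a b) w) (hq : Torus.IsSmoothSpaceTimeOn (Icc a b) q)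
    (hlin : ∀ t ∈ Icc a b, ∀ x, Torus.timeDerivWithin (Icc a b) w t x + Torus.convect (u t) (w t) x +
      Torus.convect (w t) (u t) x = ν • Torus.laplacian (w t) x - Torus.gradient (q t) x + g t x)
    (hab : a < b) (hν : 0 ≤ ν) (i j : d) {t : ℝ} (ht : t ∈ Icc a b) :
    (∫ x, |torusVorticityTensor (w t) i j x|) - (∫ x, |torusVorticityTensor (w a) i j x|) ≤
      ∫ τ in a..t, ∫ x, |(Torus.partialDeriv i (g τ) x j - Torus.partialDeriv j (g τ) x i) -
        ((∑ k, (Torus.partialDeriv i (u τ) x k * Torus.partialDeriv k (w τ) x j +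
            Torus.partialDeriv i (w τ) x k * Torus.partialDeriv k (u τ) x j)) -
          ∑ k, (Torus.partialDeriv j (u τ) x k * Torus.partialDeriv k (w τ) x i +
            Torus.partialDeriv j (w τ) x k * Torus.partialDeriv k (u τ) x i)) -
        ∑ k, w τ x k * Torus.partialDeriv k (torusVorticityTensor (u τ) i j) x| :=
  (linearisedNSForced_isClassicalScalarTransportForcedOn_torusVorticityTensor hu hudiv hw hq hlin hab
    i j).integral_abs_sub_le hν Subset.rfl ht

end AnyDimension

/-! ### Part 2. The plane: `B₀₁ = (div u) ω + (div w) Ω̄`, and `ω` as a forced passive scalar -/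

section Plane

/-- **The planar stretching–tilting bracket is a divergence term.** For `2 × 2` arrays `P`
(`Pᵢₖ = (∂ᵢu)ₖ`) and `Q` (`Qᵢₖ = (∂ᵢw)ₖ`):
`∑ₖ(P₀ₖQₖ₁ + Q₀ₖPₖ₁) − ∑ₖ(P₁ₖQₖ₀ + Q₁ₖPₖ₀) = (P₀₀ + P₁₁)(Q₀₁ − Q₁₀) + (Q₀₀ + Q₁₁)(P₀₁ − P₁₀)`,
i.e. `B₀₁(∇u, ∇w) = (div u)·ω + (div w)·Ω̄` — the polarisation of "the vorticity-stretching term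
vanishes, `ω·∇v ≡ 0`" for planar flows (Majda–Bertozzi 2002, §2.1 before (2.6)). [cite: MajdaBertozziCUP2002, §2.1 eqs. (2.5)–(2.6)] -/
theorem stretchTilt_fin_two (P Q : Fin 2 → Fin 2 → ℝ) :
    (∑ k, (P 0 k * Q k 1 + Q 0 k * P k 1)) - ∑ k, (P 1 k * Q k 0 + Q 1 k * P k 0) =
      (P 0 0 + P 1 1) * (Q 0 1 - Q 1 0) + (Q 0 0 + Q 1 1) * (P 0 1 - P 1 0) := by
  simp only [Fin.sum_univ_two]
  ring

/-- `|ω|² = W₀₁²` on `T²`: the tree's orientation-free `torusVorticitySqAt v x = ½∑ᵢⱼWᵢⱼ²` is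
the square of the scalar vorticity `W₀₁ = ∂₀v₁ − ∂₁v₀` (Majda–Bertozzi 2002, §2.1: "the scalar
vorticity `ω = v²_{x₁} − v¹_{x₂}`"). [cite: MajdaBertozziCUP2002, §2.1 eqs. (2.5)–(2.6)] -/
theorem torusVorticitySqAt_fin_two (v : UnitAddTorus (Fin 2) → EuclideanSpace ℝ (Fin 2)) (x : UnitAddTorus (Fin 2)) :
    torusVorticitySqAt v x = torusVorticityTensor v 0 1 x ^ 2 := by
  simp only [torusVorticitySqAt, torusVorticityTensor, Fin.sum_univ_two]
  ring

/-- **`‖ω‖₂² = ‖∇w‖₂²` for divergence-free planar fields**: `∫_{T²} W₀₁² = Torus.gradNormSq w`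
for smooth divergence-free `w : T² → ℝ²` (the tree's `∫ |ω|² = 2ℰ = ‖∇u‖₂²`,
`integral_torusVorticitySqAt_eq_two_mul_torusEnstrophy`, read on `T²`; Ayala–Protas 2017 (2.4)).
[cite: AyalaProtas2017, eqs. (2.3)–(2.4)] -/
theorem integral_vorticity_sq_eq_gradNormSq_fin_two {w : UnitAddTorus (Fin 2) → EuclideanSpace ℝ (Fin 2)} (hw : Torus.IsSmooth w)
    (hdiv : Torus.IsDivFree w) :
    ∫ x, torusVorticityTensor w 0 1 x ^ 2 = Torus.gradNormSq w := by
  have h := integral_torusVorticitySqAt_eq_two_mul_torusEnstrophy hw hdiv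
  simp_rw [torusVorticitySqAt_fin_two] at h
  rw [h, torusEnstrophy]
  ring

variable {a b ν : ℝ} {u w g : ℝ → UnitAddTorus (Fin 2) → EuclideanSpace ℝ (Fin 2)} {q : ℝ → UnitAddTorus (Fin 2) → ℝ}

/-- On `T²`, for `C¹` fields `u`, `w` at a point where both are divergence free, the
stretching–tilting bracket `B₀₁(∇u(x), ∇w(x))` vanishes. [cite: MajdaBertozziCUP2002, §2.1 eqs. (2.5)–(2.6)] -/
theorem stretchTilt_eq_zero_of_divergence_eq_zero {u w : UnitAddTorus (Fin 2) → EuclideanSpace ℝ (Fin 2)} (hu : Torus.IsContDiff 1 u)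
    (hw : Torus.IsContDiff 1 w) {x : UnitAddTorus (Fin 2)} (hux : Torus.divergence u x = 0)
    (hwx : Torus.divergence w x = 0) :
    (∑ k, (Torus.partialDeriv 0 u x k * Torus.partialDeriv k w x 1 +
        Torus.partialDeriv 0 w x k * Torus.partialDeriv k u x 1)) -
      ∑ k, (Torus.partialDeriv 1 u x k * Torus.partialDeriv k w x 0 +
        Torus.partialDeriv 1 w x k * Torus.partialDeriv k u x 0) = 0 := by
  rw [stretchTilt_fin_two (fun i k => Torus.partialDeriv i u x k) (fun i k => Torus.partialDeriv i w x k)]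
  rw [Torus.divergence_eq_sum_partialDeriv_apply hu x, Fin.sum_univ_two] at hux
  rw [Torus.divergence_eq_sum_partialDeriv_apply hw x, Fin.sum_univ_two] at hwx
  rw [hux, hwx]
  ring

/-- **The planar linearised vorticity equation: `ω` is a forced passive scalar of the background.**
On `T²`, along a jointly smooth divergence-free background `u` on `[a, b]` (`a < b`), for a
classical solution `(w, q)` with divergence-free slices of `∂ₜw + (u·∇)w + (w·∇)u = νΔw − ∇q + g`,
the scalar vorticity `ω = ∂₀w₁ − ∂₁w₀` (`torusVorticityTensor (w t) 0 1`) is a classical solution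
of `∂ₜω + ⟪u, ∇ω⟫ = νΔω + s` with source `s = (∂₀g₁ − ∂₁g₀) − ⟪w, ∇Ω̄⟫`, `Ω̄ = ∂₀u₁ − ∂₁u₀` the
background vorticity — Shvydkoy–Latushkin 2005, §2: `curl(−⟨u,∇⟩v − ⟨v,∇⟩u − ∇P) =
−⟨u,∇⟩curl v − ⟨v,∇⟩curl u` "since both `u` and `v` are divergence free, by standard vector
identities" (their `L = curl ∘ L_vel ∘ curl⁻¹`), here with viscosity and a force. [cite: ShvydkoyLatushkin2005, §2 (identity curl L_vel v = L curl v, before Remark 1)] -/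
theorem linearisedNSForced_isClassicalScalarTransportForcedOn_vorticity_fin_two
    (hu : Torus.IsSmoothSpaceTimeOn (Icc a b) u) (hudiv : ∀ t ∈ Icc a b, Torus.IsDivFree (u t))
    (hw : Torus.IsSmoothSpaceTimeOn (Icc a b) w) (hq : Torus.IsSmoothSpaceTimeOn (Icc a b) q)
    (hwdiv : ∀ t ∈ Icc a b, Torus.IsDivFree (w t))
    (hlin : ∀ t ∈ Icc a b, ∀ x, Torus.timeDerivWithin (Icc a b) w t x + Torus.convect (u t) (w t) x +
      Torus.convect (w t) (u t) x = ν • Torus.laplacian (w t) x - Torus.gradient (q t) x + g t x)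
    (hab : a < b) :
    Torus.IsClassicalScalarTransportForcedOn (Icc a b) ν u
      (fun t x => (Torus.partialDeriv 0 (g t) x 1 - Torus.partialDeriv 1 (g t) x 0) -
        ⟪w t x, Torus.gradient (torusVorticityTensor (u t) 0 1) x⟫_ℝ)
      (fun t x => torusVorticityTensor (w t) 0 1 x) := by
  have hU : UniqueDiffOn ℝ (Icc a b) := uniqueDiffOn_Icc hab
  have h := linearisedNSForced_isClassicalScalarTransportForcedOn_torusVorticityTensor hu hudiv hw hq
    hlin hab 0 1
  have hgst := linearisedNSForced_isSmoothSpaceTimeOn_force hu hw hq hlin hab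
  have hΩ : Torus.IsSmoothSpaceTimeOn (Icc a b) (fun t => torusVorticityTensor (u t) 0 1) :=
    isSmoothSpaceTimeOn_torusVorticityTensor hu hab 0 1
  have hs' : Torus.IsSmoothSpaceTimeOn (Icc a b) (fun t x =>
      (Torus.partialDeriv 0 (g t) x 1 - Torus.partialDeriv 1 (g t) x 0) -
        ⟪w t x, Torus.gradient (torusVorticityTensor (u t) 0 1) x⟫_ℝ) :=
    (((hgst.partialDeriv hU 0).apply 1).sub ((hgst.partialDeriv hU 1).apply 0)).sub
      (hw.inner (hΩ.gradient hU))
  refine h.congr_source hs' fun t ht x => ?_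
  have hut : Torus.IsSmooth (u t) := hu.isSmooth_slice ht
  have hwt : Torus.IsSmooth (w t) := hw.isSmooth_slice ht
  have hΩt : Torus.IsSmooth (torusVorticityTensor (u t) 0 1) := hΩ.isSmooth_slice ht
  have hB := stretchTilt_eq_zero_of_divergence_eq_zero (hut.isContDiff (by simp))
    (hwt.isContDiff (by simp)) (hudiv t ht x) (hwdiv t ht x)
  rw [hB, sub_zero, Torus.inner_gradient_eq_sum_mul_partialDeriv (hΩt.isContDiff (by simp)) (w t x) x]

/-- Unforced form: along a divergence-free background on `T²`, the vorticity of a classical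
divergence-free solution of `∂ₜw + (u·∇)w + (w·∇)u = νΔw − ∇q` is a classical forced passive
scalar with drift `u` and source `−⟪w, ∇Ω̄⟫`, `Ω̄ = ∂₀u₁ − ∂₁u₀` (Shvydkoy–Latushkin 2005, §2,
`Lw = −⟨u,∇⟩w − ⟨curl⁻¹w, ∇⟩curl u`, with viscosity). [cite: ShvydkoyLatushkin2005, §2 (identity curl L_vel v = L curl v, before Remark 1)] -/
theorem linearisedNS_isClassicalScalarTransportForcedOn_vorticity_fin_two
    (hu : Torus.IsSmoothSpaceTimeOn (Icc a b) u) (hudiv : ∀ t ∈ Icc a b, Torus.IsDivFree (u t))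
    (hw : Torus.IsSmoothSpaceTimeOn (Icc a b) w) (hq : Torus.IsSmoothSpaceTimeOn (Icc a b) q)
    (hwdiv : ∀ t ∈ Icc a b, Torus.IsDivFree (w t))
    (hlin : ∀ t ∈ Icc a b, ∀ x, Torus.timeDerivWithin (Icc a b) w t x + Torus.convect (u t) (w t) x +
      Torus.convect (w t) (u t) x = ν • Torus.laplacian (w t) x - Torus.gradient (q t) x)
    (hab : a < b) :
    Torus.IsClassicalScalarTransportForcedOn (Icc a b) ν u
      (fun t x => -⟪w t x, Torus.gradient (torusVorticityTensor (u t) 0 1) x⟫_ℝ)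
      (fun t x => torusVorticityTensor (w t) 0 1 x) := by
  have hU : UniqueDiffOn ℝ (Icc a b) := uniqueDiffOn_Icc hab
  have hlin' : ∀ t ∈ Icc a b, ∀ x, Torus.timeDerivWithin (Icc a b) w t x + Torus.convect (u t) (w t) x +
      Torus.convect (w t) (u t) x = ν • Torus.laplacian (w t) x - Torus.gradient (q t) x +
        (0 : ℝ → UnitAddTorus (Fin 2) → EuclideanSpace ℝ (Fin 2)) t x := fun t ht x => by
    rw [hlin t ht x, Pi.zero_apply, Pi.zero_apply, add_zero]
  have h := linearisedNSForced_isClassicalScalarTransportForcedOn_vorticity_fin_two hu hudiv hw hq hwdiv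
    hlin' hab
  have hΩ : Torus.IsSmoothSpaceTimeOn (Icc a b) (fun t => torusVorticityTensor (u t) 0 1) :=
    isSmoothSpaceTimeOn_torusVorticityTensor hu hab 0 1
  refine h.congr_source (hw.inner (hΩ.gradient hU)).neg fun t ht x => ?_
  have h0 : ∀ i, Torus.partialDeriv i (0 : UnitAddTorus (Fin 2) → EuclideanSpace ℝ (Fin 2)) x = 0 := fun i => by
    change Torus.partialDeriv i (fun _ : UnitAddTorus (Fin 2) => (0 : EuclideanSpace ℝ (Fin 2))) x = 0
    simp [Torus.partialDeriv, Torus.lineDeriv]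
  have e0 : (0 : ℝ → UnitAddTorus (Fin 2) → EuclideanSpace ℝ (Fin 2)) t = (0 : UnitAddTorus (Fin 2) → EuclideanSpace ℝ (Fin 2)) := rfl
  simp only [e0, h0, PiLp.zero_apply, sub_self, zero_sub]

/-! ### Part 3. The maximum principle and the enstrophy balance of the planar linearised response -/

/-- **Maximum principle for the planar linearised vorticity.** Under the hypotheses of
`linearisedNSForced_isClassicalScalarTransportForcedOn_vorticity_fin_two` with `ν ≥ 0`, if
`|ω(a, ·)| ≤ M` and the source is dominated by a continuous `F`,
`|(∂₀g₁ − ∂₁g₀)(τ, y) − ⟪w(τ, y), ∇Ω̄(τ, y)⟫| ≤ F(τ)` on `[a, b] × T²`, then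
`|ω(t, x)| ≤ M + ∫ₐᵗ F` for `t ∈ [a, b]`: incompressible transport and diffusion never raise
`sup|ω|`, only the source does (Majda–Bertozzi 2002, §3.3 before Cor. 3.3, the planar
vorticity maximum principle, here with a right-hand side; tree
`Torus.abs_le_add_integral_of_source`, Evans 2010 §7.1.4). [cite: Evans2010, §7.1.4 Thm. 8–9 (weak maximum principle with source)] -/
theorem linearisedNSForced_abs_vorticity_le_fin_two
    (hu : Torus.IsSmoothSpaceTimeOn (Icc a b) u) (hudiv : ∀ t ∈ Icc a b, Torus.IsDivFree (u t))
    (hw : Torus.IsSmoothSpaceTimeOn (Icc a b) w) (hq : Torus.IsSmoothSpaceTimeOn (Icc a b) q)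
    (hwdiv : ∀ t ∈ Icc a b, Torus.IsDivFree (w t))
    (hlin : ∀ t ∈ Icc a b, ∀ x, Torus.timeDerivWithin (Icc a b) w t x + Torus.convect (u t) (w t) x +
      Torus.convect (w t) (u t) x = ν • Torus.laplacian (w t) x - Torus.gradient (q t) x + g t x)
    (hab : a < b) (hν : 0 ≤ ν) {M : ℝ} (hM : ∀ x, |torusVorticityTensor (w a) 0 1 x| ≤ M)
    {F : ℝ → ℝ} (hF : ContinuousOn F (Icc a b))
    (hsF : ∀ τ ∈ Icc a b, ∀ y, |(Torus.partialDeriv 0 (g τ) y 1 - Torus.partialDeriv 1 (g τ) y 0) -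
      ⟪w τ y, Torus.gradient (torusVorticityTensor (u τ) 0 1) y⟫_ℝ| ≤ F τ)
    {t : ℝ} (ht : t ∈ Icc a b) (x : UnitAddTorus (Fin 2)) :
    |torusVorticityTensor (w t) 0 1 x| ≤ M + ∫ τ in a..t, F τ := by
  have h := linearisedNSForced_isClassicalScalarTransportForcedOn_vorticity_fin_two hu hudiv hw hq hwdiv
    hlin hab
  exact Torus.abs_le_add_integral_of_source h.smooth_scalar h.transport hν Subset.rfl hM hsF hF ht x

/-- **The vorticity of the unforced planar linearised response grows at most additively, at rate
`sup|w| · sup|∇Ω̄|`, uniformly in `ν ≥ 0`.** Along a divergence-free background `u` on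
`[a, b] × T²`, for a classical divergence-free solution of `∂ₜw + (u·∇)w + (w·∇)u = νΔw − ∇q`
with `|ω(a, ·)| ≤ M`, `‖w(τ, ·)‖ ≤ M_w(τ)` and `‖∇Ω̄(τ, ·)‖ ≤ G(τ)` (`Ω̄ = ∂₀u₁ − ∂₁u₀`;
`M_w, G ≥ 0` continuous): `|ω(t, x)| ≤ M + ∫ₐᵗ M_w G`. For a shear background `u = r(τ)U(xᵢ)eⱼ`,
`∇Ω̄ = ±rU″(xᵢ)eᵢ` lives on the curvature set of the profile. (Planar vorticity maximum principle,
Majda–Bertozzi 2002 §3.3, with the linearised source `−⟪w, ∇Ω̄⟫` of Shvydkoy–Latushkin 2005 §2.)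
[cite: Evans2010, §7.1.4 Thm. 8–9 (weak maximum principle with source)] -/
theorem linearisedNS_abs_vorticity_le_of_norm_le_fin_two
    (hu : Torus.IsSmoothSpaceTimeOn (Icc a b) u) (hudiv : ∀ t ∈ Icc a b, Torus.IsDivFree (u t))
    (hw : Torus.IsSmoothSpaceTimeOn (Icc a b) w) (hq : Torus.IsSmoothSpaceTimeOn (Icc a b) q)
    (hwdiv : ∀ t ∈ Icc a b, Torus.IsDivFree (w t))
    (hlin : ∀ t ∈ Icc a b, ∀ x, Torus.timeDerivWithin (Icc a b) w t x + Torus.convect (u t) (w t) x +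
      Torus.convect (w t) (u t) x = ν • Torus.laplacian (w t) x - Torus.gradient (q t) x)
    (hab : a < b) (hν : 0 ≤ ν) {M : ℝ} (hM : ∀ x, |torusVorticityTensor (w a) 0 1 x| ≤ M)
    {Mw G : ℝ → ℝ} (hMwc : ContinuousOn Mw (Icc a b)) (hGc : ContinuousOn G (Icc a b))
    (hMw : ∀ τ ∈ Icc a b, ∀ y, ‖w τ y‖ ≤ Mw τ)
    (hG : ∀ τ ∈ Icc a b, ∀ y, ‖Torus.gradient (torusVorticityTensor (u τ) 0 1) y‖ ≤ G τ)
    {t : ℝ} (ht : t ∈ Icc a b) (x : UnitAddTorus (Fin 2)) :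
    |torusVorticityTensor (w t) 0 1 x| ≤ M + ∫ τ in a..t, Mw τ * G τ := by
  have h := linearisedNS_isClassicalScalarTransportForcedOn_vorticity_fin_two hu hudiv hw hq hwdiv hlin hab
  refine Torus.abs_le_add_integral_of_source h.smooth_scalar h.transport hν Subset.rfl hM
    (fun τ hτ y => ?_) (hMwc.mul hGc) ht x
  rw [abs_neg]
  calc |⟪w τ y, Torus.gradient (torusVorticityTensor (u τ) 0 1) y⟫_ℝ|
      ≤ ‖w τ y‖ * ‖Torus.gradient (torusVorticityTensor (u τ) 0 1) y‖ := abs_real_inner_le_norm _ _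
    _ ≤ Mw τ * G τ := mul_le_mul (hMw τ hτ y) (hG τ hτ y) (norm_nonneg _)
        ((norm_nonneg _).trans (hMw τ hτ y))

/-- **Enstrophy balance of the planar linearised response.** Under the hypotheses of
`linearisedNSForced_isClassicalScalarTransportForcedOn_vorticity_fin_two`, for `t ∈ [a, b]`:
`d/dt ∫ ω² = −2ν ∫ ‖∇ω‖² + 2 ∫ ω s` within `[a, b]`, `s = (∂₀g₁ − ∂₁g₀) − ⟪w, ∇Ω̄⟫` — the
transport term drops by incompressibility of the background (the renormalised balance
`IsClassicalScalarTransportForcedOn.hasDerivWithinAt_integral_comp` with `β(r) = r²`;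
DiPerna–Lions 1989 §II.3, classical case). [cite: DiPernaLions1989Invent, §II.3] -/
theorem linearisedNSForced_hasDerivWithinAt_integral_vorticity_sq_fin_two
    (hu : Torus.IsSmoothSpaceTimeOn (Icc a b) u) (hudiv : ∀ t ∈ Icc a b, Torus.IsDivFree (u t))
    (hw : Torus.IsSmoothSpaceTimeOn (Icc a b) w) (hq : Torus.IsSmoothSpaceTimeOn (Icc a b) q)
    (hwdiv : ∀ t ∈ Icc a b, Torus.IsDivFree (w t))
    (hlin : ∀ t ∈ Icc a b, ∀ x, Torus.timeDerivWithin (Icc a b) w t x + Torus.convect (u t) (w t) x +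
      Torus.convect (w t) (u t) x = ν • Torus.laplacian (w t) x - Torus.gradient (q t) x + g t x)
    (hab : a < b) {t : ℝ} (ht : t ∈ Icc a b) :
    HasDerivWithinAt (fun τ => ∫ x, torusVorticityTensor (w τ) 0 1 x ^ 2)
      (-(2 * ν * ∫ x, ‖Torus.gradient (torusVorticityTensor (w t) 0 1) x‖ ^ 2) +
        2 * ∫ x, torusVorticityTensor (w t) 0 1 x *
          ((Torus.partialDeriv 0 (g t) x 1 - Torus.partialDeriv 1 (g t) x 0) -
            ⟪w t x, Torus.gradient (torusVorticityTensor (u t) 0 1) x⟫_ℝ))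
      (Icc a b) t := by
  have h := linearisedNSForced_isClassicalScalarTransportForcedOn_vorticity_fin_two hu hudiv hw hq hwdiv
    hlin hab
  have h1 := h.hasDerivWithinAt_integral_comp (convex_Icc a b) (β := fun r => r ^ 2)
    (contDiff_id.pow 2) ht
  have e1 : deriv (fun r : ℝ => r ^ 2) = fun r => 2 * r := by
    funext r; simp
  have e2 : deriv (fun r : ℝ => 2 * r) = fun _ => 2 := by
    funext r
    rw [deriv_const_mul 2 differentiableAt_id, deriv_id'', mul_one]
  rw [e1, e2] at h1
  have eW : (fun x => torusVorticityTensor (w t) 0 1 x) = torusVorticityTensor (w t) 0 1 := rfl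
  simp only [eW] at h1
  convert h1 using 1
  rw [integral_const_mul, ← integral_const_mul 2]
  congr 1
  · ring
  · refine integral_congr_ae (ae_of_all _ fun x => ?_)
    ring

/-- Comparison lemma on a window `[a, t]` (time-translate of the tree's
`Torus.sqrt_le_sqrt_add_integral_of_hasDerivWithinAt` on `[0, T]`): `φ ≥ 0` with continuous
one-sided derivative `D ≤ 2√φ·g`, `g ≥ 0` continuous, gives `√(φ(t)) ≤ √(φ(a)) + ∫ₐᵗ g`. [folklore] -/
private theorem sqrt_le_sqrt_add_integral_Icc {φ D G : ℝ → ℝ} {a t : ℝ} (hat : a ≤ t)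
    (hφ : ∀ τ ∈ Icc a t, HasDerivWithinAt φ (D τ) (Icc a t) τ) (hD : ContinuousOn D (Icc a t))
    (hpos : ∀ τ ∈ Icc a t, 0 ≤ φ τ) (hle : ∀ τ ∈ Icc a t, D τ ≤ 2 * Real.sqrt (φ τ) * G τ)
    (hG0 : ∀ τ ∈ Icc a t, 0 ≤ G τ) (hG : ContinuousOn G (Icc a t)) :
    Real.sqrt (φ t) ≤ Real.sqrt (φ a) + ∫ τ in a..t, G τ := by
  set T : ℝ := t - a with hT
  have hT0 : 0 ≤ T := by rw [hT]; linarith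
  have hmaps : MapsTo (fun σ : ℝ => a + σ) (Icc (0 : ℝ) T) (Icc a t) := by
    intro σ hσ
    exact ⟨by linarith [hσ.1], by rw [hT] at hσ; linarith [hσ.2]⟩
  have hsh : ∀ σ : ℝ, HasDerivWithinAt (fun σ : ℝ => a + σ) 1 (Icc (0 : ℝ) T) σ := fun σ =>
    ((hasDerivAt_id σ).const_add a).hasDerivWithinAt
  have hcsh : ContinuousOn (fun σ : ℝ => a + σ) (Icc (0 : ℝ) T) :=
    (continuous_const.add continuous_id).continuousOn
  have hφ' : ∀ σ ∈ Icc (0 : ℝ) T, HasDerivWithinAt (fun σ => φ (a + σ)) (D (a + σ)) (Icc 0 T) σ := by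
    intro σ hσ
    have h := (hφ (a + σ) (hmaps hσ)).comp σ (hsh σ) hmaps
    simpa only [mul_one, Function.comp_def] using h
  have hD' : ContinuousOn (fun σ => D (a + σ)) (Icc (0 : ℝ) T) := hD.comp hcsh hmaps
  have hG' : ContinuousOn (fun σ => G (a + σ)) (Icc (0 : ℝ) T) := hG.comp hcsh hmaps
  have key := Torus.sqrt_le_sqrt_add_integral_of_hasDerivWithinAt (φ := fun σ => φ (a + σ))
    (D := fun σ => D (a + σ)) (g := fun σ => G (a + σ)) hT0 hφ' hD'
    (fun σ hσ => hpos _ (hmaps hσ)) (fun σ hσ => hle _ (hmaps hσ)) (fun σ hσ => hG0 _ (hmaps hσ))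
    (hG'.intervalIntegrable_of_Icc hT0)
  have e1 : a + T = t := by rw [hT]; ring
  simp only [add_zero, e1] at key
  rw [intervalIntegral.integral_comp_add_left (fun τ => G τ) a, add_zero, e1] at key
  exact key

/-- **The enstrophy of the planar linearised response grows at most additively by the `L²` size
of the source, uniformly in `ν ≥ 0`.** Under the hypotheses of
`linearisedNSForced_isClassicalScalarTransportForcedOn_vorticity_fin_two` with `ν ≥ 0`: if the
source `s = (∂₀g₁ − ∂₁g₀) − ⟪w, ∇Ω̄⟫` obeys `‖s(τ)‖_{L²} ≤ G(τ)` on `[a, b]` (`G ≥ 0`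
continuous), then `‖ω(t)‖_{L²} ≤ ‖ω(a)‖_{L²} + ∫ₐᵗ G` for `t ∈ [a, b]` — from the enstrophy
balance `d/dt‖ω‖² = −2ν‖∇ω‖² + 2∫ωs ≤ 2‖ω‖‖s‖` (DiPerna–Lions 1989 §II.3 renormalisation with
`β = r²`, integrated; for the unforced planar Navier–Stokes vorticity this is the monotonicity of
the enstrophy, Majda–Bertozzi 2002 §3.3). In particular (unforced case, `‖∇Ω̄(τ,·)‖ ≤ K(τ)`) one
may take `G = K · ‖w‖_{L²}`: the response's enstrophy is fed by its `L²` size on the support of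
`∇Ω̄`. [cite: DiPernaLions1989Invent, §II.3] -/
theorem linearisedNSForced_sqrt_integral_vorticity_sq_le_fin_two
    (hu : Torus.IsSmoothSpaceTimeOn (Icc a b) u) (hudiv : ∀ t ∈ Icc a b, Torus.IsDivFree (u t))
    (hw : Torus.IsSmoothSpaceTimeOn (Icc a b) w) (hq : Torus.IsSmoothSpaceTimeOn (Icc a b) q)
    (hwdiv : ∀ t ∈ Icc a b, Torus.IsDivFree (w t))
    (hlin : ∀ t ∈ Icc a b, ∀ x, Torus.timeDerivWithin (Icc a b) w t x + Torus.convect (u t) (w t) x +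
      Torus.convect (w t) (u t) x = ν • Torus.laplacian (w t) x - Torus.gradient (q t) x + g t x)
    (hab : a < b) (hν : 0 ≤ ν) {G : ℝ → ℝ} (hGc : ContinuousOn G (Icc a b))
    (hG0 : ∀ τ ∈ Icc a b, 0 ≤ G τ)
    (hsG : ∀ τ ∈ Icc a b, Real.sqrt (∫ x, ((Torus.partialDeriv 0 (g τ) x 1 - Torus.partialDeriv 1 (g τ) x 0) -
      ⟪w τ x, Torus.gradient (torusVorticityTensor (u τ) 0 1) x⟫_ℝ) ^ 2) ≤ G τ)
    {t : ℝ} (ht : t ∈ Icc a b) :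
    Real.sqrt (∫ x, torusVorticityTensor (w t) 0 1 x ^ 2) ≤
      Real.sqrt (∫ x, torusVorticityTensor (w a) 0 1 x ^ 2) + ∫ τ in a..t, G τ := by
  rcases eq_or_lt_of_le ht.1 with rfl | hat
  · simp
  have h := linearisedNSForced_isClassicalScalarTransportForcedOn_vorticity_fin_two hu hudiv hw hq hwdiv
    hlin hab
  -- restrict to the window `[a, t]`
  have hsub : Icc a t ⊆ Icc a b := Icc_subset_Icc_right ht.2
  have h' := h.restrict_Icc hat hsub
  set vort : ℝ → UnitAddTorus (Fin 2) → ℝ := fun τ x => torusVorticityTensor (w τ) 0 1 x with hvort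
  set src : ℝ → UnitAddTorus (Fin 2) → ℝ := fun τ x =>
    (Torus.partialDeriv 0 (g τ) x 1 - Torus.partialDeriv 1 (g τ) x 0) -
      ⟪w τ x, Torus.gradient (torusVorticityTensor (u τ) 0 1) x⟫_ℝ with hsrc
  set E : ℝ → ℝ := fun τ => ∫ x, vort τ x ^ 2 with hE
  set D : ℝ → ℝ := fun τ => -(2 * ν * ∫ x, ‖Torus.gradient (vort τ) x‖ ^ 2) +
    2 * ∫ x, vort τ x * src τ x with hD
  have e1 : deriv (fun r : ℝ => r ^ 2) = fun r => 2 * r := by funext r; simp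
  have e2 : deriv (fun r : ℝ => 2 * r) = fun _ => (2 : ℝ) := by
    funext r; rw [deriv_const_mul 2 differentiableAt_id, deriv_id'', mul_one]
  have hEd : ∀ τ ∈ Icc a t, HasDerivWithinAt E (D τ) (Icc a t) τ := by
    intro τ hτ
    have h1 := h'.hasDerivWithinAt_integral_comp (convex_Icc a t) (β := fun r : ℝ => r ^ 2)
      (contDiff_id.pow 2) hτ
    rw [e1, e2] at h1
    dsimp only at h1
    have ia : ∫ x, (2 : ℝ) * ‖Torus.gradient (vort τ) x‖ ^ 2 =
        2 * ∫ x, ‖Torus.gradient (vort τ) x‖ ^ 2 := integral_const_mul _ _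
    have ib : ∫ x, 2 * vort τ x * src τ x = 2 * ∫ x, vort τ x * src τ x := by
      rw [← integral_const_mul]
      refine integral_congr_ae (ae_of_all _ fun x => ?_)
      ring
    convert h1 using 1
    rw [hD, ia, ib]
    ring
  -- continuity of `D` on `[a, t]` from the joint smoothness of the integrands
  have hU : UniqueDiffOn ℝ (Icc a t) := uniqueDiffOn_Icc hat
  have hvst : Torus.IsSmoothSpaceTimeOn (Icc a t) vort := h'.smooth_scalar
  have hsrcst : Torus.IsSmoothSpaceTimeOn (Icc a t) src := h'.smooth_source
  have hg2 : Torus.IsSmoothSpaceTimeOn (Icc a t) (fun τ x => ‖Torus.gradient (vort τ) x‖ ^ 2) := by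
    change ContDiffOn ℝ ∞ (fun z => ‖Torus.stLift (fun τ => Torus.gradient (vort τ)) z‖ ^ 2)
      (Icc a t ×ˢ Set.univ)
    exact (hvst.gradient hU).norm_sq ℝ
  have hDc : ContinuousOn D (Icc a t) := by
    have c1 : ContinuousOn (fun τ => ∫ x, ‖Torus.gradient (vort τ) x‖ ^ 2) (Icc a t) :=
      hg2.continuousOn_integral (convex_Icc a t)
    have c2 : ContinuousOn (fun τ => ∫ x, vort τ x * src τ x) (Icc a t) :=
      (hvst.mul hsrcst).continuousOn_integral (convex_Icc a t)
    have c : ContinuousOn (fun τ => -(2 * ν * ∫ x, ‖Torus.gradient (vort τ) x‖ ^ 2) +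
        2 * ∫ x, vort τ x * src τ x) (Icc a t) :=
      (continuousOn_const.mul c1).neg.add (continuousOn_const.mul c2)
    exact c
  have hEpos : ∀ τ ∈ Icc a t, 0 ≤ E τ := fun τ _ => integral_nonneg fun x => sq_nonneg _
  -- the differential inequality `E' ≤ 2 √E · G`
  have hle : ∀ τ ∈ Icc a t, D τ ≤ 2 * Real.sqrt (E τ) * G τ := by
    intro τ hτ
    have hvτ : Torus.IsSmooth (vort τ) := hvst.isSmooth_slice hτ
    have hsrcτ : Torus.IsSmooth (src τ) := hsrcst.isSmooth_slice hτ
    have i1 : -(2 * ν * ∫ x, ‖Torus.gradient (vort τ) x‖ ^ 2) ≤ 0 := by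
      have : 0 ≤ ∫ x, ‖Torus.gradient (vort τ) x‖ ^ 2 := integral_nonneg fun x => sq_nonneg _
      nlinarith
    have i2 : 2 * ∫ x, vort τ x * src τ x ≤ 2 * Real.sqrt (E τ) * G τ := by
      have hcs := Torus.integral_mul_le_sqrt_mul_sqrt hvτ.continuous hsrcτ.continuous
      have hs2 := hsG τ (hsub hτ)
      have hE0 : 0 ≤ Real.sqrt (E τ) := Real.sqrt_nonneg _
      calc 2 * ∫ x, vort τ x * src τ x
          ≤ 2 * (Real.sqrt (∫ x, vort τ x ^ 2) * Real.sqrt (∫ x, src τ x ^ 2)) := by linarith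
        _ ≤ 2 * (Real.sqrt (E τ) * G τ) := by
            gcongr
        _ = 2 * Real.sqrt (E τ) * G τ := by ring
    have hDτ : D τ = -(2 * ν * ∫ x, ‖Torus.gradient (vort τ) x‖ ^ 2) +
        2 * ∫ x, vort τ x * src τ x := rfl
    rw [hDτ]
    linarith
  exact sqrt_le_sqrt_add_integral_Icc hat.le hEd hDc hEpos hle (fun τ hτ => hG0 τ (hsub hτ))
    (hGc.mono hsub)

/-- **`L¹` growth of the planar linearised vorticity** (`ν ≥ 0`): on `[a, b]`,
`∫ |ω(t)| − ∫ |ω(a)| ≤ ∫ₐᵗ ∫ |(∂₀g₁ − ∂₁g₀) − ⟪w, ∇Ω̄⟫|` (Gallay–Wayne 2005, Lemma 3.1 with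
a right-hand side; tree `IsClassicalScalarTransportForcedOn.integral_abs_sub_le`). [cite: GallayWayne2005, Lemma 3.1] -/
theorem linearisedNSForced_integral_abs_vorticity_sub_le_fin_two
    (hu : Torus.IsSmoothSpaceTimeOn (Icc a b) u) (hudiv : ∀ t ∈ Icc a b, Torus.IsDivFree (u t))
    (hw : Torus.IsSmoothSpaceTimeOn (Icc a b) w) (hq : Torus.IsSmoothSpaceTimeOn (Icc a b) q)
    (hwdiv : ∀ t ∈ Icc a b, Torus.IsDivFree (w t))
    (hlin : ∀ t ∈ Icc a b, ∀ x, Torus.timeDerivWithin (Icc a b) w t x + Torus.convect (u t) (w t) x +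
      Torus.convect (w t) (u t) x = ν • Torus.laplacian (w t) x - Torus.gradient (q t) x + g t x)
    (hab : a < b) (hν : 0 ≤ ν) {t : ℝ} (ht : t ∈ Icc a b) :
    (∫ x, |torusVorticityTensor (w t) 0 1 x|) - (∫ x, |torusVorticityTensor (w a) 0 1 x|) ≤
      ∫ τ in a..t, ∫ x, |(Torus.partialDeriv 0 (g τ) x 1 - Torus.partialDeriv 1 (g τ) x 0) -
        ⟪w τ x, Torus.gradient (torusVorticityTensor (u τ) 0 1) x⟫_ℝ| :=
  (linearisedNSForced_isClassicalScalarTransportForcedOn_vorticity_fin_two hu hudiv hw hq hwdiv hlin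
    hab).integral_abs_sub_le hν Subset.rfl ht

end Plane

end Torus

end Literature.Analysis.FluidPDE

end
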